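import Summits.CriticalPhenomena.CardyFormulaZ2.Theorems.CardyBondTriangularBondTriangularCardyBlueArmCycleFacts
import HarnessLib

/-!
# Route CardyBondTriangular · crux `BondTriangularCardy` · line `birth`: the blue arm of Claim 10 — contacts of the cycle with the yellow boundary

Helper of the stub `stub_blueArm`; port of `TriClaim10Cycle.lean` §§Reversed, Contacts, Bump to
the kite walk (Bollobás–Riordan, *Percolation* (2006), Ch. 7, pp. 178–179). In the frame of `A₀`
(separating yellow path `Q` from the tail of position `nᵤ ∈ [pos 1, pos 2)` to that of
`nᵥ ∈ [pos 2, #∂)`, both end darts yellow towards the outside, `w` to the left of the chord loop,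
no yellow path separating `w`) along a cycle of the kite interface whose first left kite sits at
`w`: **a yellow path traversing a necklace bond backwards separates `w`**
(`cyc_false_of_reversed_dart`); **the walk touches the yellow boundary only outside `(nᵤ, nᵥ)`**
(`cyc_outer_pos` — in the Chayes–Lei model the end darts of `Q` themselves may be touched, their
tails being possibly blue at one end); the positions of the contacts with `A₁` (below `u`) and
`A₂` (beyond `v`) (`cyc_one_contact_pos`, `cyc_two_contact_pos`); a block of outer right cells
entered across `A₂` is left across `A₂` (`cyc_block_exit_two`); and the bump lemma
(`false_of_bump`, with the non-separation of the complementary path as a hypothesis).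

## References

* B. Bollobás, O. Riordan, *Percolation*, CUP (2006), Ch. 7, Claim 10 pp. 178–179.
-/

namespace Summit.CriticalPhenomena.CardyFormulaZ2.Theorems.BondTriangularCardyLine.KiteB

open Finset Literature.Probability.Percolation Literature.Probability.LatticeModels
open TriMarkedDomain (fin3_add_one_add_one fin3_add_two_add_one fin3_add_two_add_two fin3_add_one_add_two)

/-! ### Yellow paths in the Chayes–Lei form give the loop data of `…KiteBLabel` -/

section LoopData

variable {D : TriMarkedDomain 3} {σ : CLHexConfig}

/-- The darts of a yellow path of hexagons of `G` are yellow at a common corner, as kite colours. -/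
theorem ccolDarts_of_clYellow {Q : List (Site 2)} (hQG : ∀ s ∈ Q, s ∈ D.verts)
    (hQY : ∀ d ∈ pathDarts Q, (clYellowGraph σ).Adj d.1 d.2) :
    ∀ d ∈ pathDarts Q, ∃ G : HexVertex, d.1 ∈ hexFaceVertices G ∧ d.2 ∈ hexFaceVertices G ∧
      ccol D σ d.1 G = true ∧ ccol D σ d.2 G = true := by
  intro d hd
  obtain ⟨-, G, h1, h2, c1, c2⟩ := (clYellowGraph_adj_iff σ _ _).1 (hQY d hd)
  obtain ⟨m1, m2⟩ := mem_of_mem_pathDarts hd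
  exact ⟨G, h1, h2, by rw [ccol_of_mem (hQG _ m1) h1]; simpa using c1, by rw [ccol_of_mem (hQG _ m2) h2]; simpa using c2⟩

/-- A hexagon yellow towards the outer head of a boundary dart, as kite colours. -/
theorem ccol_of_yellowTowards {n : ℕ} {x : Site 2} (hx : x = (triBdryIter D.verts D.base n).1)
    (hY : YellowTowards σ (triBdryIter D.verts D.base n)) :
    ∃ G : HexVertex, x ∈ hexFaceVertices G ∧ D.bdryHead n ∈ hexFaceVertices G ∧ ccol D σ x G = true := by
  obtain ⟨G, h1, h2, c⟩ := hY
  subst hx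
  exact ⟨G, h1, h2, by rw [ccol_of_mem (D.iter_fst_mem n) h1]; simpa using c⟩

end LoopData

/-- **At the mark `v₂` the tail does not change**: the tails at positions `pos 2 - 1` and `pos 2`
agree (registered anchor of this file). -/
theorem iter_fst_pos_two_pred : ∀ (D : Literature.Probability.Percolation.TriMarkedDomain 3), (Literature.Probability.Percolation.triBdryIter D.verts D.base (D.pos 2 - 1)).1 = (Literature.Probability.Percolation.triBdryIter D.verts D.base (D.pos 2)).1 := by
  intro D
  have h12 := D.pos_lt_pos₃ (show (1 : Fin 3) < 2 by decide)
  have := D.mark_pred 2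
  rw [show D.pos 2 + (#(triBdryDarts D.verts) - 1) = (D.pos 2 - 1) + #(triBdryDarts D.verts) by
    have := D.pos_lt 2; omega, D.iter_add_card] at this
  exact this

section Frame

variable (D : TriMarkedDomain 3) {σ : CLHexConfig} {w : HexVertex} {orb : ℕ → KDart} {N : ℕ}
  (horb : ∀ k < N, succ (kcol D σ) (orb k) = orb (k + 1))
  (hiface : ∀ k < N, iface (kcol D σ) (orb k) = true) (hadm : ∀ k < N, (orb k).adm = true)
  (hleft : ∀ k < N, (orb k).leftCell ∈ D.verts) (hretG : (orb N).leftCell ∈ D.verts) (hbc0 : (orb 0).leftCorner = w)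
  (hnotw : ∀ (Q' : List (Site 2)) (hne : Q' ≠ []), Q'.Nodup → List.IsChain triGraph.Adj Q' →
    (∀ s ∈ Q', s ∈ D.verts ∧ σ s ≠ CLHexState.B) → (∀ d ∈ pathDarts Q', (clYellowGraph σ).Adj d.1 d.2) →
    ∀ nu' nv' : ℕ, D.pos 1 ≤ nu' → nu' < D.pos 2 → D.pos 2 ≤ nv' → nv' < #(triBdryDarts D.verts) →
    Q'.head hne = (triBdryIter D.verts D.base nu').1 → YellowTowards σ (triBdryIter D.verts D.base nu') →
    Q'.getLast hne = (triBdryIter D.verts D.base nv').1 → YellowTowards σ (triBdryIter D.verts D.base nv') →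
    ¬ Separates D.verts {e : Sym2 (Site 2) | ∃ d ∈ pathDarts Q', e = s(d.1, d.2)} w (D.stretch 0))

include horb hiface hadm hleft hretG hbc0 hnotw in
/-- **A yellow path traversing a necklace bond backwards separates `w` from `A₀`** — against the
standing hypothesis (`TriClaim10Cycle.cyc_false_of_reversed_dart`): the corner of the left kite
when the right cell turns from `p` to `q` is the face left of `p → q`, right of the path's dart
`q → p`, of label `leftLabel + 1`; the walk never crosses the path's chord loop, so `w` has the
same label; but `w` is joined off the path to a face of `A₀`, of label `leftLabel`. -/
theorem cyc_false_of_reversed_dart {P' : List (Site 2)} (hP'ne : P' ≠ []) (hP'nd : P'.Nodup)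
    (hP'ch : List.IsChain triGraph.Adj P') (hP'G : ∀ s ∈ P', s ∈ D.verts) (hP'B : ∀ s ∈ P', σ s ≠ CLHexState.B)
    (hP'Y : ∀ d ∈ pathDarts P', (clYellowGraph σ).Adj d.1 d.2) (hP'2 : 2 ≤ P'.length)
    {nu' nv' : ℕ} (hnu1 : D.pos 1 ≤ nu') (hnu2 : nu' < D.pos 2) (hnv2 : D.pos 2 ≤ nv')
    (hnvL : nv' < #(triBdryDarts D.verts))
    (hhead : P'.head hP'ne = (triBdryIter D.verts D.base nu').1) (hYu : YellowTowards σ (triBdryIter D.verts D.base nu'))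
    (hlast : P'.getLast hP'ne = (triBdryIter D.verts D.base nv').1) (hYv : YellowTowards σ (triBdryIter D.verts D.base nv'))
    {i : ℕ} (hi : i + 1 ≤ N) (hρ : (orb i).rightCell ≠ (orb (i + 1)).rightCell)
    (hdart : ((orb (i + 1)).rightCell, (orb i).rightCell) ∈ pathDarts P') : False := by
  set L := #(triBdryDarts D.verts) with hL
  have hlen : nv' + (nu' + L - nv') = nu' + L := by omega
  have hC' := D.isTriLoop_chordLoop_frame hP'ne hP'nd hP'ch hP'G hP'2 hnu2 hnv2 hnvL hhead hlast
  set C' := D.chordLoop P' nv' (nu' + L - nv') with hC'def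
  -- `w` is joined off `P'` to a face of `A₀`
  have hns := hnotw P' hP'ne hP'nd hP'ch (fun s hs => ⟨hP'G s hs, hP'B s hs⟩) hP'Y nu' nv' hnu1 hnu2 hnv2 hnvL hhead hYu hlast hYv
  unfold Separates at hns
  push Not at hns
  obtain ⟨F, hF, hreach⟩ := hns
  have hπw : faceLabel (cycDarts C') w = leftLabel C' := by
    rw [D.faceLabel_chordLoop_eq_of_reflTransGen hP'ne hC' hreach]
    exact D.faceLabel_eq_leftLabel_of_stretch_zero hP'ne hP'G hnu1 hnu2 hnv2 hnvL hlen hC' hF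
  -- the walk never crosses `C'`
  have hheadc : ∃ G : HexVertex, P'.head hP'ne ∈ hexFaceVertices G ∧ D.bdryHead (nv' + (nu' + L - nv')) ∈ hexFaceVertices G ∧
      ccol D σ (P'.head hP'ne) G = true := by
    rw [hlen, D.bdryHead_add_card]; exact ccol_of_yellowTowards hhead hYu
  have hinv := cyc_faceLabel_leftCorner_eq D horb hiface hadm hleft hP'ne (ccolDarts_of_clYellow hP'G hP'Y)
    (ccol_of_yellowTowards hlast hYv) hheadc hC'.adj hretG i (by omega)
  have hface : leftFace (orb i).rightCell (orb (i + 1)).rightCell = (orb i).leftCorner := by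
    rw [← horb i (by omega)] at hρ ⊢
    exact leftFace_rightCell_succ (hadm i (by omega)) hρ.symm
  rw [hbc0, hπw, ← hface] at hinv
  have hright := hC'.faceLabel_rightFace (D.mem_cycDarts_chordLoop_of_mem_pathDarts (nv := nv') hP'ne (nu' + L - nv') hdart)
  simp only at hright
  rw [hright] at hinv
  have key : ∀ a : ZMod 2, a + 1 ≠ a := by decide
  exact key _ hinv

variable {Q : List (Site 2)} (hQne : Q ≠ []) (hQG : ∀ s ∈ Q, s ∈ D.verts)
  (hQY : ∀ d ∈ pathDarts Q, (clYellowGraph σ).Adj d.1 d.2)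
  {nu nv : ℕ} (hnu1 : D.pos 1 ≤ nu) (hnu2 : nu < D.pos 2) (hnv2 : D.pos 2 ≤ nv) (hnvL : nv < #(triBdryDarts D.verts))
  (hQhead : Q.head hQne = (triBdryIter D.verts D.base nu).1) (hYu : YellowTowards σ (triBdryIter D.verts D.base nu))
  (hQlast : Q.getLast hQne = (triBdryIter D.verts D.base nv).1) (hYv : YellowTowards σ (triBdryIter D.verts D.base nv))
  (hC : IsTriLoop (D.chordLoop Q nv (nu + #(triBdryDarts D.verts) - nv)))
  (hπw : faceLabel (cycDarts (D.chordLoop Q nv (nu + #(triBdryDarts D.verts) - nv))) w =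
    leftLabel (D.chordLoop Q nv (nu + #(triBdryDarts D.verts) - nv)))

include horb hiface hadm hleft hretG hbc0 hQG hQY hnu1 hnu2 hnv2 hnvL hQhead hYu hQlast hYv hC hπw in
/-- **The walk touches the yellow boundary only outside `(nᵤ, nᵥ)`**: at a step whose right cell is
an outer cell, the boundary dart from the left cell is not at a position strictly between `nᵤ`
and `nᵥ` (the face left of that dart would have label `leftLabel + 1`, while it has the label of
`w`, `leftLabel` — unless the dart is an end dart of `Q`, at position `nᵤ` or `nᵥ`). -/
theorem cyc_outer_pos {k : ℕ} (hk : k < N) (hout : (orb k).rightCell ∉ D.verts) :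
    ¬ (nu < D.dpos ((orb k).leftCell, (orb k).rightCell) ∧ D.dpos ((orb k).leftCell, (orb k).rightCell) < nv) := by
  rintro ⟨h1, h2⟩
  set L := #(triBdryDarts D.verts) with hL
  have hlen : nv + (nu + L - nv) = nu + L := by omega
  have hd := (bdry_of_rightCell_out (hiface k hk) (hadm k hk) (hleft k hk) hout).1
  set q := D.dpos ((orb k).leftCell, (orb k).rightCell) with hq
  have hiter : triBdryIter D.verts D.base q = ((orb k).leftCell, (orb k).rightCell) := D.iter_dpos hd
  have hheadc : ∃ G : HexVertex, Q.head hQne ∈ hexFaceVertices G ∧ D.bdryHead (nv + (nu + L - nv)) ∈ hexFaceVertices G ∧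
      ccol D σ (Q.head hQne) G = true := by
    rw [hlen, D.bdryHead_add_card]; exact ccol_of_yellowTowards hQhead hYu
  have hinv := cyc_faceLabel_leftCorner_eq D horb hiface hadm hleft hQne (ccolDarts_of_clYellow hQG hQY)
    (ccol_of_yellowTowards hQlast hYv) hheadc hC.adj hretG k hk.le
  rcases faceLabel_leftFace_outer hQne hQG hC.adj (hiface k hk) (hadm k hk) (hleft k hk) hout with hlab | ⟨hl, hr⟩ | ⟨hl, hr⟩
  · have hγ := D.faceLabel_eq_leftLabel_add_one_of_mem_Ico hQne hQG (nu := nu) (nv := nv) (len := nu + L - nv)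
      (by omega) (by omega) hlen hQlast (by rw [hlen, D.iter_add_card]; exact hQhead) hC (q := q) h1.le (by omega)
    rw [hiter] at hγ
    simp only at hγ
    change faceLabel _ (leftFace (orb k).leftCell (D.bdryHead q)) = _ at hγ
    have hh : D.bdryHead q = (orb k).rightCell := by unfold TriMarkedDomain.bdryHead; rw [hiter]
    rw [hh, hlab, hinv, hbc0, hπw] at hγ
    have key : ∀ a : ZMod 2, a ≠ a + 1 := by decide
    exact key _ hγ
  · -- the end dart at `nᵥ`
    have he : ((orb k).leftCell, (orb k).rightCell) = triBdryIter D.verts D.base nv := by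
      rw [hl, hr, hQlast]; rfl
    have : q = nv := by rw [hq, he, D.dpos_iter, Nat.mod_eq_of_lt hnvL]
    omega
  · -- the end dart at `nᵤ`
    have he : ((orb k).leftCell, (orb k).rightCell) = triBdryIter D.verts D.base nu := by
      rw [hl, hr, hQhead, hlen, D.bdryHead_add_card]; rfl
    have : q = nu := by rw [hq, he, D.dpos_iter, Nat.mod_eq_of_lt (by omega)]
    omega

include horb hiface hadm hleft hretG hbc0 hQG hQY hnu1 hnu2 hnv2 hnvL hQhead hYu hQlast hYv hC hπw in
/-- **A contact with `A₁` happens below `u`**: if the right cell `ρₖ ∈ G`, not the first hexagon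
of `Q`, is followed by an outer right cell seen across a dart of `A₁`, that dart is at a position
`n' < nᵤ` (with `pos 1 ≤ n'`, tail `ρₖ`). -/
theorem cyc_one_contact_pos {k : ℕ} (hk : k + 1 < N) (hin : (orb k).rightCell ∈ D.verts)
    (hout : (orb (k + 1)).rightCell ∉ D.verts)
    (h1 : D.stretchIdx₃ (D.dpos ((orb k).rightCell, (orb (k + 1)).rightCell)) = 1)
    (hne : (orb k).rightCell ≠ Q.head hQne) :
    ((orb k).rightCell, (orb (k + 1)).rightCell) ∈ triBdryDarts D.verts ∧
      D.pos 1 ≤ D.dpos ((orb k).rightCell, (orb (k + 1)).rightCell) ∧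
      D.dpos ((orb k).rightCell, (orb (k + 1)).rightCell) < nu ∧
      (triBdryIter D.verts D.base (D.dpos ((orb k).rightCell, (orb (k + 1)).rightCell))).1 = (orb k).rightCell := by
  set L := #(triBdryDarts D.verts) with hL
  have h12 := D.pos_lt_pos₃ (show (1 : Fin 3) < 2 by decide)
  have h2L := D.pos_lt 2
  have hG' : (succ (kcol D σ) (orb k)).leftCell ∈ D.verts := by rw [horb k (by omega)]; exact hleft (k + 1) hk
  obtain ⟨hd, -, htr⟩ := trans_in_out (hiface k (by omega)) (hadm k (by omega)) (hleft k (by omega)) hG' hin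
    (by rw [horb k (by omega)]; exact hout)
  rw [horb k (by omega)] at hd htr
  set n' := D.dpos ((orb k).rightCell, (orb (k + 1)).rightCell) with hn'
  have hlt' := D.dpos_lt hd
  have hrange : D.pos 1 ≤ n' ∧ n' < D.pos 2 := by
    unfold TriMarkedDomain.stretchIdx₃ at h1
    rw [Nat.mod_eq_of_lt hlt'] at h1
    by_cases ha : n' < D.pos 1
    · rw [if_pos ha] at h1; exact absurd h1 (by decide)
    · rw [if_neg ha] at h1
      by_cases hb : n' < D.pos 2
      · exact ⟨by omega, hb⟩
      · rw [if_neg hb] at h1; exact absurd h1 (by decide)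
  have htail : (triBdryIter D.verts D.base n').1 = (orb k).rightCell := by rw [D.iter_dpos hd]
  refine ⟨hd, hrange.1, ?_, htail⟩
  have hpos := cyc_outer_pos D horb hiface hadm hleft hretG hbc0 hQne hQG hQY hnu1 hnu2 hnv2 hnvL hQhead hYu hQlast hYv hC hπw hk hout
  rcases htr with ⟨hsucc, hneq, hℓeq⟩ | hsame
  · -- around a corner: the new dart is the successor, at position `n' + 1`
    have hq : D.dpos ((orb (k + 1)).leftCell, (orb (k + 1)).rightCell) = n' + 1 := by
      rw [hsucc, D.dpos_succ hd, Nat.mod_eq_of_lt (by omega)]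
    rw [hq] at hpos
    by_contra hge
    push Not at hge
    have hnv : nv ≤ n' + 1 := by by_contra h'; exact hpos ⟨by omega, by omega⟩
    -- then `n' + 1 = pos 2 = nᵥ`, the tails at `n'` and `n' + 1` agree: `ρₖ = ℓₖ`
    have heq : n' + 1 = D.pos 2 := by omega
    have ht : (triBdryIter D.verts D.base (n' + 1)).1 = (orb k).rightCell := by
      rw [← htail, heq, show n' = D.pos 2 - 1 by omega]; exact (iter_fst_pos_two_pred D).symm
    have hℓ : (orb (k + 1)).leftCell = (orb k).leftCell := hℓeq
    have : (triBdryIter D.verts D.base (n' + 1)).1 = (orb (k + 1)).leftCell := by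
      rw [triBdryIter_succ, hn', D.iter_dpos hd, ← hsucc]
    rw [this, hℓ] at ht
    exact hneq ht
  · -- emerging onto the boundary: the new dart is the entry dart, at position `n'`
    have hq : D.dpos ((orb (k + 1)).leftCell, (orb (k + 1)).rightCell) = n' := by rw [hsame]
    rw [hq] at hpos
    by_contra hge
    push Not at hge
    have hle : n' ≤ nu := by by_contra h'; exact hpos ⟨by omega, by omega⟩
    have heq : n' = nu := le_antisymm hle hge
    apply hne
    rw [← htail, heq, ← hQhead]

include horb hiface hadm hleft hretG hbc0 hQG hQY hnu1 hnu2 hnv2 hnvL hQhead hYu hQlast hYv hC hπw in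
/-- **A contact with `A₂` happens beyond `v`**: if the right cell `ρₖ₊₁ ∈ G`, not the last hexagon
of `Q`, is preceded by an outer right cell seen across a dart of `A₂`, that dart is at a position
`n'' > nᵥ` (tail `ρₖ₊₁`). -/
theorem cyc_two_contact_pos {k : ℕ} (hk : k + 1 < N) (hout : (orb k).rightCell ∉ D.verts)
    (hin : (orb (k + 1)).rightCell ∈ D.verts)
    (h2 : D.stretchIdx₃ (D.dpos ((orb (k + 1)).rightCell, (orb k).rightCell)) = 2)
    (hne : (orb (k + 1)).rightCell ≠ Q.getLast hQne) :
    ((orb (k + 1)).rightCell, (orb k).rightCell) ∈ triBdryDarts D.verts ∧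
      nv < D.dpos ((orb (k + 1)).rightCell, (orb k).rightCell) ∧
      D.dpos ((orb (k + 1)).rightCell, (orb k).rightCell) < #(triBdryDarts D.verts) ∧
      (triBdryIter D.verts D.base (D.dpos ((orb (k + 1)).rightCell, (orb k).rightCell))).1 = (orb (k + 1)).rightCell := by
  set L := #(triBdryDarts D.verts) with hL
  have h12 := D.pos_lt_pos₃ (show (1 : Fin 3) < 2 by decide)
  have h2L := D.pos_lt 2
  have hG' : (succ (kcol D σ) (orb k)).leftCell ∈ D.verts := by rw [horb k (by omega)]; exact hleft (k + 1) hk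
  have hpair := (bdry_of_rightCell_out (hiface k (by omega)) (hadm k (by omega)) (hleft k (by omega)) hout).1
  set q := D.dpos ((orb k).leftCell, (orb k).rightCell) with hq
  have hqlt := D.dpos_lt hpair
  have hpos := cyc_outer_pos D horb hiface hadm hleft hretG hbc0 hQne hQG hQY hnu1 hnu2 hnv2 hnvL hQhead hYu hQlast hYv hC hπw
    (show k < N by omega) hout
  have htr := trans_out_in (hiface k (by omega)) (hadm k (by omega)) (hleft k (by omega)) hG' hout
    (by rw [horb k (by omega)]; exact hin)
  rw [horb k (by omega)] at htr
  -- the stretch index `2` in terms of positions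
  have hstretch2 : ∀ {d}, d ∈ triBdryDarts D.verts → D.stretchIdx₃ (D.dpos d) = 2 → D.pos 2 ≤ D.dpos d := by
    intro d hd hs
    have hlt' := D.dpos_lt hd
    unfold TriMarkedDomain.stretchIdx₃ at hs
    rw [Nat.mod_eq_of_lt hlt'] at hs
    by_contra hb
    push Not at hb
    by_cases ha : D.dpos d < D.pos 1
    · rw [if_pos ha] at hs; exact absurd hs (by decide)
    · rw [if_neg ha, if_pos hb] at hs; exact absurd hs (by decide)
  rcases htr with hdive | ⟨hsucc, hneℓ, -, -⟩
  · -- dived into the left cell: the dart is the one from the left cell, at position `q`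
    have he : ((orb (k + 1)).rightCell, (orb k).rightCell) = ((orb k).leftCell, (orb k).rightCell) := by rw [hdive]
    rw [he]
    have hq2 := hstretch2 hpair (by rw [← he]; exact h2)
    refine ⟨hpair, ?_, hqlt, by rw [D.iter_dpos hpair, hdive]⟩
    rcases Nat.lt_or_ge nv q with h | h
    · exact h
    · exfalso
      have hqv : q = nv := by
        by_contra hne'
        exact hpos ⟨by omega, lt_of_le_of_ne h hne'⟩
      apply hne
      rw [hdive, hQlast]
      have := D.iter_dpos hpair
      rw [show D.dpos ((orb k).leftCell, (orb k).rightCell) = nv from hqv] at this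
      rw [this]
  · -- around the corner: the dart is the successor, at position `q + 1`
    have hd : ((orb (k + 1)).rightCell, (orb k).rightCell) ∈ triBdryDarts D.verts := by rw [hsucc]; exact triBdrySucc_mem hpair
    have hn'' : D.dpos ((orb (k + 1)).rightCell, (orb k).rightCell) = (q + 1) % L := by rw [hsucc, D.dpos_succ hpair]
    have hge := hstretch2 hd h2
    rw [hn''] at hge ⊢
    have hq1 : q + 1 < L := by
      by_contra hw
      have : q + 1 = L := by omega
      rw [this, Nat.mod_self] at hge
      omega
    have hnowrap : (q + 1) % L = q + 1 := Nat.mod_eq_of_lt hq1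
    rw [hnowrap] at hge ⊢
    refine ⟨hd, ?_, hq1, by rw [← hnowrap, ← hn'', D.iter_dpos hd]⟩
    by_contra hle
    push Not at hle
    -- `q ∉ (nᵤ, nᵥ)` and `q + 1 ≥ pos 2 > nᵤ`: so `q = nᵤ = pos 2 - 1`, and the new right cell is the left cell
    have hqu : q = nu := by
      rcases Nat.lt_or_ge nu q with h | h
      · exact absurd ⟨h, by omega⟩ hpos
      · omega
    have hp2 : D.pos 2 = q + 1 := by omega
    apply hneℓ
    have e1 : (orb (k + 1)).rightCell = (triBdryIter D.verts D.base (q + 1)).1 := by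
      rw [triBdryIter_succ, hq, D.iter_dpos hpair, ← hsucc]
    have e2 : (orb k).leftCell = (triBdryIter D.verts D.base q).1 := by rw [hq, D.iter_dpos hpair]
    rw [e1, e2, ← hp2, show q = D.pos 2 - 1 by omega]
    exact (iter_fst_pos_two_pred D).symm

end Frame

end Summit.CriticalPhenomena.CardyFormulaZ2.Theorems.BondTriangularCardyLine.KiteB
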